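import Summits.AnomalousDissipation.AnomalousDissipation.Theorems.GalerkinInvariantLoud.Negative.Clauses

/-!
# Negative knowledge for the crux `MomentParity.GalerkinInvariantLoud` (stmt-AnomalousDissipation-14283), III:
# finitely atomic invariant laws are mixtures of Galerkin steady states

Certified copy of §4 of the cdisprove work file `Cruxes/GalerkinInvariantLoud/Disproof.lean`
(refuter-cdisprove-stmt-AnomalousDissipation-14283-0, cycle 1). Supports stmt-AnomalousDissipation-14283; no
conclusion asserts a Theses decl positively.

* §4a gradient interpolation at finitely many points of `ℝ^m` by `(X_{i₀} − c_a(i₀)) Π_{b≠a} |X − c_b|⁴`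
  (`interp`, `eval_pderiv_interp_self`, `eval_pderiv_interp_of_ne`).
* §4b `eq_of_pairing_frameG_eq` (frame coordinates separate level-`N` fields), `steady_of_isInvariant_atomic`
  (atoms of a finitely atomic all-order stationary law are Galerkin steady states, `IsGalerkinSteady`),
  `isInvariant_atomic_of_steady` (converse), `exists_efficient_steady_atom` (an atomic witness of the crux contains a
  steady atom with `ε‖u‖² ≤ E·ν‖∇u‖²`). The designer-measure freedom of the lower rungs is void for this crux.
-/

namespace Summit.AnomalousDissipation.AnomalousDissipation.Theorems.GalerkinInvariantLoud.Negative

open MeasureTheory Filter Topology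
open scoped ENNReal InnerProductSpace RealInnerProductSpace
open Literature.Analysis.FunctionSpaces Literature.Analysis.FluidPDE
open Summit.AnomalousDissipation.AnomalousDissipation.Theses.MomentParity
open Summit.AnomalousDissipation.AnomalousDissipation.Theorems
open Summit.AnomalousDissipation.AnomalousDissipation.Theorems.QuarticGate.Negative

noncomputable section

-- `T3`, `R3`, `H3`, `L2T3` (torus, values, energy space, `L²`), the level-`N` Galerkin frame `frameG N`
-- and the energy polynomial `energyPoly` are the sibling seat's (CubicParityLoud) abbreviations.
open Summit.AnomalousDissipation.AnomalousDissipation.Theorems.CubicParityLoud.Negative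
  (T3 R3 H3 L2T3 frameG energyPoly isBandTest_frameG eval_pderiv_energyPoly polyGrad_energy
   fourierTruncate_ae_eq_of_isLevel eGradNormSq_fourierTruncate_of_isLevel eGradNormSq_lt_top_of_isLevel
   inertialPairing_fourierTruncate_of_isLevel integral_inner_fourierTruncate_of_isLevel integrable_pairing)

/-! ## §4 NEW — finitely atomic witnesses are mixtures of Galerkin STEADY states

### §4a Polynomial interpolation of gradients at finitely many points of `ℝ^m` -/

section Interp

variable {m : ℕ}

/-- Squared distance to `c`: `Σⱼ (Xⱼ − cⱼ)²`. -/
def sqDist (c : Fin m → ℝ) : MvPolynomial (Fin m) ℝ :=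
  ∑ j, (MvPolynomial.X j - MvPolynomial.C (c j)) ^ 2

/-- The bump `(Σⱼ (Xⱼ − cⱼ)²)²`, vanishing to second order at `c` and positive elsewhere. -/
def bump (c : Fin m → ℝ) : MvPolynomial (Fin m) ℝ := sqDist c ^ 2

/-- `sqDist c` evaluates to the squared distance. -/
theorem eval_sqDist (c v : Fin m → ℝ) : MvPolynomial.eval v (sqDist c) = ∑ j, (v j - c j) ^ 2 := by
  simp [sqDist, map_sum]

/-- `sqDist c` vanishes at `c`. -/
theorem eval_sqDist_self (c : Fin m → ℝ) : MvPolynomial.eval c (sqDist c) = 0 := by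
  simp [eval_sqDist]

/-- `bump c` evaluates to the fourth power of the distance. -/
theorem eval_bump (c v : Fin m → ℝ) : MvPolynomial.eval v (bump c) = (∑ j, (v j - c j) ^ 2) ^ 2 := by
  simp [bump, eval_sqDist]

/-- `bump c` vanishes at `c`. -/
theorem eval_bump_self (c : Fin m → ℝ) : MvPolynomial.eval c (bump c) = 0 := by
  simp [eval_bump]

/-- `bump c` is positive away from `c`. -/
theorem eval_bump_pos {c v : Fin m → ℝ} (h : v ≠ c) : 0 < MvPolynomial.eval v (bump c) := by
  rw [eval_bump]
  have : 0 < ∑ j, (v j - c j) ^ 2 := by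
    obtain ⟨j, hj⟩ : ∃ j, v j ≠ c j := Function.ne_iff.1 h
    exact lt_of_lt_of_le (by positivity : 0 < (v j - c j) ^ 2)
      (Finset.single_le_sum (fun i _ => sq_nonneg (v i - c i)) (Finset.mem_univ j))
  positivity

/-- The gradient of `bump c` vanishes at `c`. -/
theorem eval_pderiv_bump_self (c : Fin m → ℝ) (i : Fin m) :
    MvPolynomial.eval c (MvPolynomial.pderiv i (bump c)) = 0 := by
  rw [bump, Derivation.leibniz_pow]
  simp [eval_sqDist_self]

variable {ι : Type*} (A : Finset ι) (c : ι → Fin m → ℝ)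

/-- The interpolant attached to the atom `a` and the direction `i₀`:
`(X_{i₀} − c_a(i₀)) · Π_{b ∈ A, b ≠ a} bump(c_b)`. -/
def interp [DecidableEq ι] (a : ι) (i₀ : Fin m) : MvPolynomial (Fin m) ℝ :=
  (MvPolynomial.X i₀ - MvPolynomial.C (c a i₀)) * ∏ b ∈ A.erase a, bump (c b)

/-- At another atom `b' ∈ A`, `b' ≠ a`, with `c b' ≠ c a`... all partial derivatives of the interpolant vanish. -/
theorem eval_pderiv_interp_of_ne [DecidableEq ι] {a b' : ι} (hb' : b' ∈ A) (hne : b' ≠ a) (i₀ i : Fin m) :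
    MvPolynomial.eval (c b') (MvPolynomial.pderiv i (interp A c a i₀)) = 0 := by
  have hmem : b' ∈ A.erase a := Finset.mem_erase.2 ⟨hne, hb'⟩
  rw [interp, ← Finset.mul_prod_erase _ _ hmem, Derivation.leibniz, Derivation.leibniz]
  simp [smul_eq_mul, eval_bump_self, eval_pderiv_bump_self]

/-- At its own atom, the gradient of the interpolant is `β • e_{i₀}` with
`β = Π_{b ≠ a} bump(c_b)(c_a)`. -/
theorem eval_pderiv_interp_self [DecidableEq ι] (a : ι) (i₀ i : Fin m) :
    MvPolynomial.eval (c a) (MvPolynomial.pderiv i (interp A c a i₀)) =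
      (if i = i₀ then 1 else 0) * ∏ b ∈ A.erase a, MvPolynomial.eval (c a) (bump (c b)) := by
  rw [interp, Derivation.leibniz]
  simp only [smul_eq_mul, map_add, map_mul, map_sub, MvPolynomial.eval_X, MvPolynomial.eval_C, sub_self,
    zero_mul, zero_add, MvPolynomial.pderiv_C, sub_zero, map_prod, MvPolynomial.pderiv_X]
  by_cases h : i = i₀
  · subst h; simp
  · simp [Ne.symm h, h]

end Interp

/-! ### §4b Finitely atomic invariant laws have Galerkin-steady atoms -/

section Atomic

/-- `u ∈ H` is a GALERKIN STEADY STATE at level `N` for `(ν, f)`: the generator vanishes against every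
level-`N` band test, `⟨F(u), g⟩ = (f,g) + ν(u,Δg) + ∫(u⊗u):∇g = 0` (for level-`N` `u`: `P_N F(u) = 0`). -/
def IsGalerkinSteady (ν : ℝ) (f : T3 → R3) (N : ℕ) (u : H3) : Prop :=
  ∀ g : T3 → R3, IsBandTest N g → Torus.nsGeneratorPairing ν f u g = 0

/-- Frame reconstruction: `Σᵢ (u,gᵢ) gᵢ = P_N u` pointwise. -/
theorem sum_pairing_frameG_smul (N : ℕ) (u : H3) (x : T3) :
    ∑ i, Torus.pairing u.1 (frameG N i) • frameG N i x = Torus.fourierTruncate N ((u : L2T3) : T3 → R3) x := by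
  have h := Torus.sum_galerkinTest_eq (d := Fin 3) N one_pos (fun g => Torus.pairing u.1 g • g x)
  change ∑ i, Torus.pairing u.1 ((Torus.galerkinTest (d := Fin 3) N one_pos).g i) •
      (Torus.galerkinTest (d := Fin 3) N one_pos).g i x = _
  rw [h]
  exact Torus.sum_integral_inner_frameField_smul u.2 N x

/-- **Frame coordinates separate level-`N` fields.** -/
theorem eq_of_pairing_frameG_eq {N : ℕ} {u v : H3} (hu : IsLevel N u) (hv : IsLevel N v)
    (h : ∀ i, Torus.pairing u.1 (frameG N i) = Torus.pairing v.1 (frameG N i)) : u = v := by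
  have hP : ∀ x, Torus.fourierTruncate N ((u : L2T3) : T3 → R3) x =
      Torus.fourierTruncate N ((v : L2T3) : T3 → R3) x := fun x => by
    rw [← sum_pairing_frameG_smul N u x, ← sum_pairing_frameG_smul N v x]
    simp_rw [h]
  have hae : ((u : L2T3) : T3 → R3) =ᵐ[volume] ((v : L2T3) : T3 → R3) := by
    filter_upwards [fourierTruncate_ae_eq_of_isLevel hu, fourierTruncate_ae_eq_of_isLevel hv] with x hxu hxv
    rw [← hxu, ← hxv, hP x]
  exact Subtype.ext (Lp.ext hae)

/-- The tested generator of a polynomial observable is the gradient-weighted sum of the generators of the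
test fields: `⟨F(u), ∇p(u)⟩ = Σᵢ ∂ᵢP(coords u) ⟨F(u), gᵢ⟩`. -/
theorem nsGeneratorPairing_polyGrad {ν : ℝ} {f : T3 → R3} (hf : Integrable f volume) {m : ℕ}
    {g : Fin m → T3 → R3} (hg : ∀ i, Torus.IsSmooth (g i)) (P : MvPolynomial (Fin m) ℝ) (u : H3) :
    Torus.nsGeneratorPairing ν f u (polyGrad g P u) =
      ∑ i, MvPolynomial.eval (fun j => Torus.pairing u.1 (g j)) (MvPolynomial.pderiv i P) *
        Torus.nsGeneratorPairing ν f u (g i) :=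
  Torus.nsGeneratorPairing_sum_smul ν hf u Finset.univ _ fun i _ => hg i

variable {ι : Type*}

/-- The finitely atomic measure `Σ_{a ∈ A} w_a δ_{U a}`. -/
def atomic (A : Finset ι) (w : ι → ℝ≥0∞) (U : ι → H3) : Measure H3 :=
  ∑ a ∈ A, w a • Measure.dirac (U a)

/-- Every observable is integrable against a finitely atomic law with finite weights. -/
theorem integrable_atomic (A : Finset ι) {w : ι → ℝ≥0∞} (U : ι → H3) (hw : ∀ a ∈ A, w a ≠ ⊤)
    (G : H3 → ℝ) : Integrable G (atomic A w U) :=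
  integrable_finsetSum_measure.2 fun a ha => (Torus.integrable_dirac _ _).smul_measure (hw a ha)

/-- Integral against a finitely atomic law: `Σ_a w_a G(U a)`. -/
theorem integral_atomic (A : Finset ι) {w : ι → ℝ≥0∞} (U : ι → H3) (hw : ∀ a ∈ A, w a ≠ ⊤)
    (G : H3 → ℝ) : ∫ u, G u ∂(atomic A w U) = ∑ a ∈ A, (w a).toReal * G (U a) := by
  haveI : MeasurableSingletonClass H3 := OpensMeasurableSpace.toMeasurableSingletonClass
  rw [atomic, integral_finsetSum_measure (fun a ha => (Torus.integrable_dirac _ _).smul_measure (hw a ha))]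
  refine Finset.sum_congr rfl fun a _ => ?_
  rw [integral_smul_measure, integral_dirac, smul_eq_mul]

/-- Lower integral against a finitely atomic law: `Σ_a w_a G(U a)`. -/
theorem lintegral_atomic (A : Finset ι) (w : ι → ℝ≥0∞) (U : ι → H3) (G : H3 → ℝ≥0∞) :
    ∫⁻ u, G u ∂(atomic A w U) = ∑ a ∈ A, w a * G (U a) := by
  haveI : MeasurableSingletonClass H3 := OpensMeasurableSpace.toMeasurableSingletonClass
  rw [atomic, lintegral_finsetSum_measure]
  refine Finset.sum_congr rfl fun a _ => ?_
  rw [lintegral_smul_measure, lintegral_dirac, smul_eq_mul]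

/-- **ATOMS OF A FINITELY ATOMIC INVARIANT LAW ARE GALERKIN STEADY STATES.** If
`μ = Σ_{a∈A} w_a δ_{U a}` (positive finite weights, distinct level-`N` atoms) is all-order polynomially
stationary, then every atom is a Galerkin steady state at level `N`. (Row of the interpolant
`(X₀ − c_a(0)) Π_{b≠a} |X − c_b|⁴` in the coordinates `(g₀, frame)`: its gradient is `β e₀` at `c_a`,
`β > 0`, and `0` at the other atoms, so the row reads `w_a β ⟨F(U a), g₀⟩ = 0`.) Consequence: the
"designer atomic measure" freedom of the lower rungs (QuarticGate's recession-cone line) is VOID here —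
finitely atomic witnesses of `GalerkinInvariantLoud` are finite mixtures of loud bounded Galerkin steady
states, i.e. the open crux of route MirrorVariety (`GalerkinSteadyZerothLaw`-type statements). -/
theorem steady_of_isInvariant_atomic [DecidableEq ι] {ν : ℝ} {f : T3 → R3} (hf : Integrable f volume) {N : ℕ}
    {A : Finset ι} {w : ι → ℝ≥0∞} {U : ι → H3}
    (hw0 : ∀ a ∈ A, w a ≠ 0) (hwt : ∀ a ∈ A, w a ≠ ⊤) (hU : Set.InjOn U A)
    (hlev : ∀ a ∈ A, IsLevel N (U a)) (hinv : IsInvariant ν f N (atomic A w U)) :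
    ∀ a ∈ A, IsGalerkinSteady ν f N (U a) := by
  intro a ha g₀ hg₀
  -- the test family `(g₀, frame)` and the coordinates of the atoms
  set g : Fin ((Torus.galerkinTest (d := Fin 3) N one_pos).m + 1) → T3 → R3 := Fin.cons g₀ (frameG N) with hg
  have hgB : ∀ i, IsBandTest N (g i) := by
    refine Fin.cases ?_ ?_
    · simpa [hg] using hg₀
    · intro i
      rw [hg, Fin.cons_succ]
      exact isBandTest_frameG N i
  have hgS : ∀ i, Torus.IsSmooth (g i) := fun i => (hgB i).1
  set c : ι → Fin ((Torus.galerkinTest (d := Fin 3) N one_pos).m + 1) → ℝ :=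
    fun b j => Torus.pairing (U b).1 (g j) with hc
  -- distinct atoms have distinct coordinates
  have hcinj : ∀ b ∈ A, b ≠ a → c a ≠ c b := by
    intro b hb hba heq
    apply hba
    refine (hU ha hb ?_).symm
    refine eq_of_pairing_frameG_eq (hlev a ha) (hlev b hb) fun i => ?_
    have := congrFun heq (Fin.succ i)
    simpa [hc, hg] using this
  -- the row of the interpolant
  obtain ⟨-, hrow⟩ := hinv _ g (interp A c a 0) hgB
  rw [integral_atomic A U hwt, ← Finset.add_sum_erase _ _ ha] at hrow
  have hrest : ∑ b ∈ A.erase a, (w b).toReal *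
      Torus.nsGeneratorPairing ν f (U b) (polyGrad g (interp A c a 0) (U b)) = 0 := by
    refine Finset.sum_eq_zero fun b hb => ?_
    obtain ⟨hba, hbA⟩ := Finset.mem_erase.1 hb
    rw [nsGeneratorPairing_polyGrad hf hgS]
    have : ∀ i, MvPolynomial.eval (fun j => Torus.pairing (U b).1 (g j))
        (MvPolynomial.pderiv i (interp A c a 0)) = 0 := fun i =>
      eval_pderiv_interp_of_ne A c hbA hba 0 i
    simp [this]
  have hself : Torus.nsGeneratorPairing ν f (U a) (polyGrad g (interp A c a 0) (U a)) =
      (∏ b ∈ A.erase a, MvPolynomial.eval (c a) (bump (c b))) * Torus.nsGeneratorPairing ν f (U a) g₀ := by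
    rw [nsGeneratorPairing_polyGrad hf hgS]
    have : ∀ i, MvPolynomial.eval (fun j => Torus.pairing (U a).1 (g j))
        (MvPolynomial.pderiv i (interp A c a 0)) =
        (if i = 0 then 1 else 0) * ∏ b ∈ A.erase a, MvPolynomial.eval (c a) (bump (c b)) := fun i =>
      eval_pderiv_interp_self A c a 0 i
    simp_rw [this]
    simp [Finset.sum_ite_eq', hg]
  rw [hrest, add_zero, hself] at hrow
  have hβ : 0 < ∏ b ∈ A.erase a, MvPolynomial.eval (c a) (bump (c b)) :=
    Finset.prod_pos fun b hb => eval_bump_pos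
      (hcinj b (Finset.mem_of_mem_erase hb) (Finset.ne_of_mem_erase hb))
  have hwa : 0 < (w a).toReal := ENNReal.toReal_pos (hw0 a ha) (hwt a ha)
  rcases mul_eq_zero.1 hrow with h | h
  · exact absurd h hwa.ne'
  · rcases mul_eq_zero.1 h with h' | h'
    · exact absurd h' hβ.ne'
    · exact h'

/-- Conversely, any finite mixture of Galerkin steady states is all-order stationary (each row is a
gradient-weighted sum of vanishing generators). -/
theorem isInvariant_atomic_of_steady {ν : ℝ} {f : T3 → R3} (hf : Integrable f volume) {N : ℕ}
    {A : Finset ι} {w : ι → ℝ≥0∞} {U : ι → H3} (hwt : ∀ a ∈ A, w a ≠ ⊤)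
    (hst : ∀ a ∈ A, IsGalerkinSteady ν f N (U a)) : IsInvariant ν f N (atomic A w U) := by
  intro m g P hg
  refine ⟨integrable_atomic A U hwt _, ?_⟩
  rw [integral_atomic A U hwt]
  refine Finset.sum_eq_zero fun a ha => ?_
  rw [nsGeneratorPairing_polyGrad hf (fun i => (hg i).1)]
  simp [hst a ha _ (hg _)]

/-- Energy of an atomic law. -/
theorem ensembleEnergy_atomic (A : Finset ι) {w : ι → ℝ≥0∞} (U : ι → H3) (hw : ∀ a ∈ A, w a ≠ ⊤) :
    Torus.ensembleEnergy (atomic A w U) = ∑ a ∈ A, (w a).toReal * ‖U a‖ ^ 2 :=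
  integral_atomic A U hw _

/-- Dissipation of an atomic law with level-`N` atoms. -/
theorem ensembleDissipation_atomic {N : ℕ} (ν : ℝ) (A : Finset ι) {w : ι → ℝ≥0∞} (U : ι → H3)
    (hw : ∀ a ∈ A, w a ≠ ⊤) (hlev : ∀ a ∈ A, IsLevel N (U a)) :
    Torus.ensembleDissipation ν (atomic A w U) =
      ∑ a ∈ A, (w a).toReal * (ν * (Torus.eGradNormSq (((U a : H3) : L2T3) : T3 → R3)).toReal) := by
  unfold Torus.ensembleDissipation Torus.ensembleEnstrophy
  rw [lintegral_atomic, ENNReal.toReal_sum (fun a ha => ENNReal.mul_ne_top (hw a ha)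
    (eGradNormSq_lt_top_of_isLevel (hlev a ha)).ne), Finset.mul_sum]
  refine Finset.sum_congr rfl fun a _ => ?_
  rw [ENNReal.toReal_mul]
  ring

/-- **Pigeonhole on atomic witnesses**: a finitely atomic witness of the crux contains an EFFICIENT loud
steady atom — a level-`N` Galerkin steady state `u` with `ε‖u‖² ≤ E · ν‖∇u‖²` (dissipation-to-energy ratio
at least `ε/E`; the laminar Kolmogorov states have ratio `4π²ν → 0`, so they never serve as `ν → 0`). -/
theorem exists_efficient_steady_atom [DecidableEq ι] {ν : ℝ} {f : T3 → R3} (hf : Integrable f volume)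
    {N : ℕ} {A : Finset ι} {w : ι → ℝ≥0∞} {U : ι → H3}
    (hw0 : ∀ a ∈ A, w a ≠ 0) (hwt : ∀ a ∈ A, w a ≠ ⊤) (hU : Set.InjOn U A)
    (hlev : ∀ a ∈ A, IsLevel N (U a)) {R E ε : ℝ} (hε : 0 < ε)
    (hW : IsGILWitness f ν N R E ε (atomic A w U)) :
    ∃ a ∈ A, IsGalerkinSteady ν f N (U a) ∧
      ε * ‖U a‖ ^ 2 ≤ E * (ν * (Torus.eGradNormSq (((U a : H3) : L2T3) : T3 → R3)).toReal) := by
  obtain ⟨hprob, -, -, hinv, hE, hD⟩ := hW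
  have hst := steady_of_isInvariant_atomic hf hw0 hwt hU hlev hinv
  by_contra hno
  push Not at hno
  rw [ensembleEnergy_atomic A U hwt] at hE
  rw [ensembleDissipation_atomic ν A U hwt hlev] at hD
  -- total mass one, some atom
  have hmass : ∑ a ∈ A, (w a).toReal = 1 := by
    have h1 := integral_atomic A U hwt (fun _ => (1 : ℝ))
    simp only [mul_one] at h1
    rw [← h1, integral_const, smul_eq_mul, mul_one, probReal_univ]
  have hne : A.Nonempty := by
    by_contra h0
    rw [Finset.not_nonempty_iff_eq_empty] at h0
    rw [h0, Finset.sum_empty] at hmass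
    exact zero_ne_one hmass
  have hlt : ∑ a ∈ A, (w a).toReal * (E * (ν * (Torus.eGradNormSq (((U a : H3) : L2T3) : T3 → R3)).toReal)) <
      ∑ a ∈ A, (w a).toReal * (ε * ‖U a‖ ^ 2) :=
    Finset.sum_lt_sum_of_nonempty hne fun a ha =>
      mul_lt_mul_of_pos_left (hno a ha (hst a ha)) (ENNReal.toReal_pos (hw0 a ha) (hwt a ha))
  have h1 : ∑ a ∈ A, (w a).toReal * (E * (ν * (Torus.eGradNormSq (((U a : H3) : L2T3) : T3 → R3)).toReal)) =
      E * ∑ a ∈ A, (w a).toReal * (ν * (Torus.eGradNormSq (((U a : H3) : L2T3) : T3 → R3)).toReal) := by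
    rw [Finset.mul_sum]; exact Finset.sum_congr rfl fun a _ => by ring
  have h2 : ∑ a ∈ A, (w a).toReal * (ε * ‖U a‖ ^ 2) = ε * ∑ a ∈ A, (w a).toReal * ‖U a‖ ^ 2 := by
    rw [Finset.mul_sum]; exact Finset.sum_congr rfl fun a _ => by ring
  rw [h1, h2] at hlt
  have hEn0 : 0 ≤ ∑ a ∈ A, (w a).toReal * ‖U a‖ ^ 2 :=
    Finset.sum_nonneg fun a _ => by positivity
  nlinarith

end Atomic

end

end Summit.AnomalousDissipation.AnomalousDissipation.Theorems.GalerkinInvariantLoud.Negative
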